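import Literature.MathematicalPhysics.KineticTheory.SiteChainLangevinKernel
import Literature.Probability.Process.BrownianSupTail
import Mathlib.MeasureTheory.Integral.MeanInequalities
import HarnessLib

/-!
# The window estimate from a pathwise energy drop, for the Langevin kernels of a site-dependent chain

Topic `Literature/MathematicalPhysics/KineticTheory`. Cuneo–Eckmann–Hairer–Rey-Bellet,
*Non-equilibrium steady states for networks of oscillators*, EJP **23** (2018) no. 55, §5: the
probabilistic step of Theorem 5.1 / Lemma 5.5 that converts a PATHWISE energy drop on the event that
the bath Brownian motions stay small over a short window `[0, w]` into a decay of the exponential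
moment `P_w e^{θH}(z)`. `LangevinChainH2.lean` (`pinnedChain_window_decay_of_pathwise`) and
`LangevinChainConfinedH2Shell.lean` (`OscillatorChain.IsConfining.window_decay_of_pathwise`) prove it
for translation-invariant chains; this file is the version for the Langevin kernels
`SiteChain.langevinKernel` of a uniformly confining SITE-DEPENDENT chain (`SiteChain.UniformlyConfining`,
`SiteChainLangevinKernel.lean`: the law of the pathwise solution map `SiteChain.langevinSolMap` under
the pair of Wiener measures), with the a-priori exponential-moment bound (CEHR (3.4)) DISPLAYED as a
hypothesis (it is proved elsewhere, model by model):

* `lintegral_exp_le_of_drop_on_event` — the measure-theoretic core: for a probability measure `μ`,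
  a real function `F` with `F ≤ F₀ - D` on an event `G` and `∫ e^{pF} dμ ≤ e^{pM} e^{pF₀}` (`p > 1`),
  `∫ e^{F} dμ ≤ e^{F₀} (e^{-D} + e^{M} μ(Gᶜ)^{1-1/p})` (split over `G`/`Gᶜ`; Hölder with exponents
  `p, p/(p-1)` on `Gᶜ`);
* `SiteChain.UniformlyConfining.langevinKernel_window_decay_of_moment` — the kernel form with the
  single moment bound `P_w e^{pθH}(z) ≤ e^{pM} e^{pθH(z)}` as hypothesis;
* `SiteChain.UniformlyConfining.langevinKernel_window_decay_of_pathwise` — the kernel form with the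
  family (3.4) `P_t e^{θH}(z) ≤ e^{θγ(T_L+T_R)t} e^{θH(z)}` (`0 < θ < Θ`) as hypothesis, at `pθ < Θ`:
  `P_w e^{θH}(z) ≤ e^{θH(z)} (e^{-D} + e^{θγ(T_L+T_R)w} P(goodEventᶜ)^{1-1/p})`.

Everything is PROVED; no definition, no named fact.

## References

* N. Cuneo, J.-P. Eckmann, M. Hairer, L. Rey-Bellet, EJP **23** (2018) no. 55 (arXiv:1712.09413),
  §3 eq. (3.4), §5 Thm 5.1, Lemma 5.5.
-/

noncomputable section

open MeasureTheory ProbabilityTheory Filter Topology Set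
open scoped NNReal ENNReal

namespace Literature.MathematicalPhysics.KineticTheory.HeatConduction

open Literature.Probability.Process

/-! ### The measure-theoretic core -/

/-- **Exponential moment from a drop on a good event and a higher moment bound.** For a probability
measure `μ`, a measurable real `F` with `F ≤ F₀ - D` on the measurable event `G`, and
`∫ e^{pF} dμ ≤ e^{pM} e^{pF₀}` for some `p > 1`:
`∫ e^{F} dμ ≤ e^{F₀} (e^{-D} + e^{M} μ(Gᶜ)^{1-1/p})`. On `G` the pointwise bound is integrated; on
`Gᶜ` Hölder's inequality with exponents `p` and `p/(p-1)` is applied to `e^{F} · 1_{Gᶜ}`. [folklore] -/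
theorem lintegral_exp_le_of_drop_on_event {Ω : Type*} [MeasurableSpace Ω] (μ : Measure Ω)
    [IsProbabilityMeasure μ] {F : Ω → ℝ} (hF : Measurable F) {G : Set Ω} (hG : MeasurableSet G)
    {F₀ D M p : ℝ} (hp : 1 < p) (hdrop : ∀ x ∈ G, F x ≤ F₀ - D)
    (hmom : ∫⁻ x, ENNReal.ofReal (Real.exp (p * F x)) ∂μ ≤
      ENNReal.ofReal (Real.exp (p * M) * Real.exp (p * F₀))) :
    ∫⁻ x, ENNReal.ofReal (Real.exp (F x)) ∂μ ≤
      ENNReal.ofReal (Real.exp F₀) *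
        (ENNReal.ofReal (Real.exp (-D)) + ENNReal.ofReal (Real.exp M) * (μ Gᶜ) ^ (1 - p⁻¹)) := by
  -- adapted from `pinnedChain_window_decay_of_pathwise` (`LangevinChainH2.lean`), model-free
  set f : Ω → ℝ≥0∞ := fun x => ENNReal.ofReal (Real.exp (F x)) with hf
  have hfm : Measurable f := ENNReal.measurable_ofReal.comp (Real.measurable_exp.comp hF)
  -- the good event: the pointwise drop
  have e1 : ∫⁻ x in G, f x ∂μ ≤ ENNReal.ofReal (Real.exp F₀) * ENNReal.ofReal (Real.exp (-D)) := by
    calc ∫⁻ x in G, f x ∂μ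
        ≤ ∫⁻ _ in G, ENNReal.ofReal (Real.exp F₀) * ENNReal.ofReal (Real.exp (-D)) ∂μ := by
          refine setLIntegral_mono' hG fun x hx => ?_
          show ENNReal.ofReal (Real.exp (F x)) ≤ _
          rw [← ENNReal.ofReal_mul (Real.exp_pos _).le, ← Real.exp_add]
          exact ENNReal.ofReal_le_ofReal (Real.exp_le_exp.2 (by linarith [hdrop x hx]))
      _ = ENNReal.ofReal (Real.exp F₀) * ENNReal.ofReal (Real.exp (-D)) * μ G :=
          setLIntegral_const _ _
      _ ≤ ENNReal.ofReal (Real.exp F₀) * ENNReal.ofReal (Real.exp (-D)) * 1 := by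
          gcongr
          exact prob_le_one
      _ = _ := mul_one _
  -- the bad event: Hölder with exponents `p`, `p/(p-1)` and the moment bound
  have e2 : ∫⁻ x in Gᶜ, f x ∂μ ≤
      ENNReal.ofReal (Real.exp F₀) * (ENNReal.ofReal (Real.exp M) * (μ Gᶜ) ^ (1 - p⁻¹)) := by
    have hp0 : (0 : ℝ) < p := by linarith
    have hpq : p.HolderConjugate (Real.conjExponent p) := Real.HolderConjugate.conjExponent hp
    set g : Ω → ℝ≥0∞ := Gᶜ.indicator 1 with hg
    have hgm : Measurable g := measurable_one.indicator hG.compl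
    have e21 : ∫⁻ x in Gᶜ, f x ∂μ = ∫⁻ x, (f * g) x ∂μ := by
      rw [← lintegral_indicator hG.compl]
      refine lintegral_congr fun x => ?_
      by_cases hx : x ∈ Gᶜ
      · rw [Set.indicator_of_mem hx, Pi.mul_apply, hg, Set.indicator_of_mem hx, Pi.one_apply, mul_one]
      · rw [Set.indicator_of_notMem hx, Pi.mul_apply, hg, Set.indicator_of_notMem hx, mul_zero]
    have e22 := ENNReal.lintegral_mul_le_Lp_mul_Lq μ hpq hfm.aemeasurable hgm.aemeasurable
    have e23 : ∫⁻ x, f x ^ p ∂μ ≤ ENNReal.ofReal (Real.exp (p * M) * Real.exp (p * F₀)) := by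
      have h1 : ∀ x, f x ^ p = ENNReal.ofReal (Real.exp (p * F x)) := fun x => by
        show ENNReal.ofReal (Real.exp (F x)) ^ p = _
        rw [ENNReal.ofReal_rpow_of_pos (Real.exp_pos _), ← Real.exp_mul, mul_comm]
      simp_rw [h1]
      exact hmom
    have e24 : (∫⁻ x, f x ^ p ∂μ) ^ (1 / p) ≤ ENNReal.ofReal (Real.exp M * Real.exp F₀) := by
      refine (ENNReal.rpow_le_rpow e23 (by positivity)).trans (le_of_eq ?_)
      have h2 : (Real.exp (p * M) * Real.exp (p * F₀)) ^ (1 / p) = Real.exp M * Real.exp F₀ := by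
        rw [← Real.exp_add, ← Real.exp_add, ← Real.exp_mul]
        congr 1
        field_simp
      rw [ENNReal.ofReal_rpow_of_nonneg (by positivity) (by positivity), h2]
    have e25 : ∫⁻ x, g x ^ Real.conjExponent p ∂μ = μ Gᶜ := by
      have hq : 0 < Real.conjExponent p := hpq.symm.pos
      have h1 : ∀ x, g x ^ Real.conjExponent p = g x := fun x => by
        by_cases hx : x ∈ Gᶜ
        · rw [hg, Set.indicator_of_mem hx, Pi.one_apply, ENNReal.one_rpow]
        · rw [hg, Set.indicator_of_notMem hx, ENNReal.zero_rpow_of_pos hq]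
      simp_rw [h1, hg]
      exact lintegral_indicator_one hG.compl
    have e26 : 1 / Real.conjExponent p = 1 - p⁻¹ := by
      simp only [Real.conjExponent]
      have : p - 1 ≠ 0 := by linarith
      field_simp
    calc ∫⁻ x in Gᶜ, f x ∂μ = ∫⁻ x, (f * g) x ∂μ := e21
      _ ≤ (∫⁻ x, f x ^ p ∂μ) ^ (1 / p) *
            (∫⁻ x, g x ^ Real.conjExponent p ∂μ) ^ (1 / Real.conjExponent p) := e22
      _ ≤ ENNReal.ofReal (Real.exp M * Real.exp F₀) * (μ Gᶜ) ^ (1 - p⁻¹) := by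
          rw [e25, e26]
          gcongr
      _ = _ := by
          rw [ENNReal.ofReal_mul (Real.exp_pos _).le]
          ring
  rw [← lintegral_add_compl f hG, mul_add]
  exact add_le_add e1 e2

/-! ### The window estimate for the Langevin kernels of a uniformly confining site-dependent chain -/

namespace SiteChain.UniformlyConfining

variable {P : SiteChain} {N : ℕ}

/-- **The window estimate from a pathwise energy drop, moment form.** For the Langevin kernels
`P_t(z, ·) = law Φ_t(z, B)` of a uniformly confining site-dependent chain: if on the event
`goodEvent a w = {sup_{s≤w}|B¹_s| ≤ a, sup_{s≤w}|B²_s| ≤ a}` of the pair of bath Brownian motions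
the pathwise solution started at `z` satisfies `θH(Φ_w(z, B)) ≤ θH(z) - D`, and
`P_w e^{pθH}(z) ≤ e^{pM} e^{pθH(z)}` for some `p > 1`, then
`P_w e^{θH}(z) ≤ e^{θH(z)} (e^{-D} + e^{M} P(goodEventᶜ)^{1-1/p})`.
[cite: CuneoEckmannHairerReyBellet2018, Lemma 5.5] -/
theorem langevinKernel_window_decay_of_moment (hP : P.UniformlyConfining) (N : ℕ) (T_L T_R : ℝ)
    {θ p M : ℝ} (hp : 1 < p) (w : ℝ≥0) (a D : ℝ) (z : PhaseSpace N)
    (hmom : ∫⁻ y, ENNReal.ofReal (Real.exp (p * θ * P.hamiltonian N y))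
        ∂(P.langevinKernel N T_L T_R w z) ≤
      ENNReal.ofReal (Real.exp (p * M) * Real.exp (p * θ * P.hamiltonian N z)))
    (hgood : ∀ wp ∈ goodEvent a w,
      θ * P.hamiltonian N (P.langevinSolMap N T_L T_R w z (pairPath wp)) ≤
        θ * P.hamiltonian N z - D) :
    ∫⁻ y, ENNReal.ofReal (Real.exp (θ * P.hamiltonian N y)) ∂(P.langevinKernel N T_L T_R w z) ≤
      ENNReal.ofReal (Real.exp (θ * P.hamiltonian N z)) *
        (ENNReal.ofReal (Real.exp (-D)) +
          ENNReal.ofReal (Real.exp M) * (wienerPair (goodEvent a w)ᶜ) ^ (1 - p⁻¹)) := by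
  have hHm : Measurable (P.hamiltonian N) := (hP.contDiff_hamiltonian N).continuous.measurable
  have hΦm := hP.measurable_langevinSolMap_pairPath_right N T_L T_R w z
  have hVm : ∀ θ' : ℝ,
      Measurable fun y : PhaseSpace N => ENNReal.ofReal (Real.exp (θ' * P.hamiltonian N y)) :=
    fun θ' => ENNReal.measurable_ofReal.comp (Real.measurable_exp.comp (measurable_const.mul hHm))
  rw [hP.lintegral_langevinKernel N T_L T_R w z (hVm θ)]
  refine lintegral_exp_le_of_drop_on_event wienerPair
    (F := fun wp => θ * P.hamiltonian N (P.langevinSolMap N T_L T_R w z (pairPath wp)))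
    ((measurable_const.mul hHm).comp hΦm) (measurableSet_goodEvent a w) hp hgood ?_
  have h := hmom
  rw [hP.lintegral_langevinKernel N T_L T_R w z (hVm (p * θ))] at h
  simpa only [mul_assoc] using h

/-- **The window estimate from a pathwise energy drop** (in place of CEHR Lemma 5.5, which uses
Itô's formula and the Doléans-Dade supermartingale), for the Langevin kernels of a uniformly
confining site-dependent chain satisfying the a-priori bound (3.4)
`P_t e^{θH}(z) ≤ e^{θγ(T_L+T_R)t} e^{θH(z)}` for `0 < θ < Θ`: if on
`goodEvent a w = {sup_{s≤w}|B^{1,2}_s| ≤ a}` the pathwise solution started at `z` loses at least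
`D/θ` of energy by time `w`, then for every `p > 1` with `pθ < Θ`,
`P_w e^{θH}(z) ≤ e^{θH(z)} (e^{-D} + e^{θγ(T_L+T_R)w} P(goodEventᶜ)^{1-1/p})` (split the
expectation over the event; Hölder and (3.4) at `pθ` on the bad event).
[cite: CuneoEckmannHairerReyBellet2018, Lemma 5.5 and §3 eq. (3.4)] -/
theorem langevinKernel_window_decay_of_pathwise (hP : P.UniformlyConfining) (N : ℕ) {T_L T_R Θ : ℝ}
    (h34 : ∀ θ : ℝ, 0 < θ → θ < Θ → ∀ (t : ℝ≥0) (z : PhaseSpace N),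
      ∫⁻ y, ENNReal.ofReal (Real.exp (θ * P.hamiltonian N y)) ∂(P.langevinKernel N T_L T_R t z) ≤
        ENNReal.ofReal (Real.exp (θ * P.γ * (T_L + T_R) * t) *
          Real.exp (θ * P.hamiltonian N z)))
    {θ : ℝ} (hθ : 0 < θ) {p : ℝ} (hp : 1 < p) (hpθ : p * θ < Θ) (w : ℝ≥0) (a D : ℝ)
    (z : PhaseSpace N)
    (hgood : ∀ wp ∈ goodEvent a w,
      θ * P.hamiltonian N (P.langevinSolMap N T_L T_R w z (pairPath wp)) ≤
        θ * P.hamiltonian N z - D) :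
    ∫⁻ y, ENNReal.ofReal (Real.exp (θ * P.hamiltonian N y)) ∂(P.langevinKernel N T_L T_R w z) ≤
      ENNReal.ofReal (Real.exp (θ * P.hamiltonian N z)) *
        (ENNReal.ofReal (Real.exp (-D)) +
          ENNReal.ofReal (Real.exp (θ * P.γ * (T_L + T_R) * w)) *
            (wienerPair (goodEvent a w)ᶜ) ^ (1 - p⁻¹)) := by
  have hp0 : (0 : ℝ) < p := by linarith
  have h := h34 (p * θ) (mul_pos hp0 hθ) hpθ w z
  refine hP.langevinKernel_window_decay_of_moment N T_L T_R hp w a D z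
    (M := θ * P.γ * (T_L + T_R) * w) ?_ hgood
  simpa only [mul_assoc] using h

end SiteChain.UniformlyConfining

end Literature.MathematicalPhysics.KineticTheory.HeatConduction
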